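import Summits.Langlands.Langlands.Theorems.PicardMuOrdinaryMuOrdinaryFamilyRTPointRing
import Literature.NumberTheory.GaloisRepresentations.OrdinaryPolarizedDeformationRing
import Literature.NumberTheory.GaloisRepresentations.CarayolSerreLemmas
import Literature.NumberTheory.GaloisRepresentations.ResidualGaloisRep
import Literature.RepresentationTheory.Semisimple.BurnsideMatrixSpan

/-!
# The Picard point of line `free-seed-smooth-rt` (crux `MuOrdinaryFamilyRT`, stmt-Langlands-13757):
# the plan — leaves of the conditional proof of `stub_point`, and the small leaves proved

Helper file for the registered stub `stub_point : S.stub_point` (vocabulary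
`Theorems/PicardMuOrdinaryMuOrdinaryFamilyRTDefs.lean`, coefficient ring `O₀ ι e = ℤ₃[ζ₃]` of
`…PointRing.lean`).  The stub is proved CONDITIONALLY in the sibling file `…Point.lean`
(`stub_point_of_leaves`) from the three named facts `F1 = ordinaryPolarizedDeformationRing_nonempty`
(Mazur–Tilouine representability), `F2 = exists_descent_of_trace_mem_of_isAbsIrreducible_residual`,
`F3 = exists_conj_eq_of_trace_eq_of_isAbsIrreducible_residual` (Carayol–Serre) and from the LEAVES
stated here as `def Leaf.* : Prop` (NOTHING is asserted by a `def`; each leaf is a true, classical,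
scope-free statement to be proved as `theorem … : Leaf.…` in a sibling file):

* `Leaf.rbarTraceFrob` (Dedekind: Frobenius trace of the heart `= #roots(f mod 𝔭) - 1`),
  `Leaf.rbarUnramified`, `Leaf.rbarPolarized`, `Leaf.rbarAbsIrreducible` (heart of `A₄ ⊆ Gal`) — the
  residual datum;
* `Leaf.modelCore` (lattice + Carayol–Serre descent of `ρ_C` to `𝒪₀` with EXACT reduction `r̄_f^B`;
  uses `F2`, `F3`, `Leaf.rbarTraceFrob`, `Leaf.rbarAbsIrreducible`) and `Leaf.modelBorel` (the
  `λ`-flag of the `𝒪₀`-model is `E₀`-rational and reduces to a distinguished flag).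

Proved here: `threeUnique` (`λ` is the only prime above `3`), `isOpen_ker_rbar` (open kernel of the
heart), `hasScalarCentralizer_of_isAbsIrreducible` (Burnside), `isUpper3_iff_blockTriangular`,
`generalLinearGroup_map_injective`.
Dependency DAG: `stub_point ⇐ F1, F2, F3, rbarUnramified, rbarPolarized, rbarAbsIrreducible, modelCore,
modelBorel`; `modelCore ⇐ F2, F3, rbarTraceFrob, rbarAbsIrreducible`.
-/

-- `Summit.Langlands.Langlands.…` (summit = sub-problem name, D-0017 layout) trips `dupNamespace` on every decl.
set_option linter.dupNamespace false

namespace Summit.Langlands.Langlands.Cruxes.MuOrdinaryFamilyRT.FreeSeedSmoothRt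

open scoped NumberField Polynomial Matrix Classical
open Field IsDedekindDomain Polynomial IsLocalRing
open Literature.NumberTheory.GaloisRepresentations

noncomputable section

/-! ### The leaves (statements; each TRUE, classical, scope-free; proved in sibling files) -/

section Leaves

/-- LEAF `rbarTraceFrob` (**Dedekind + the heart trace**).  For generic `f`, a good prime
`𝔭 ∉ S(f)` and an arithmetic Frobenius `σ` at `𝔓 ∣ 𝔭`: `tr r̄_f^B(σ) = #{roots of f mod 𝔭} - 1`
in `𝔽₃` (the heart is `𝔽₃^{roots}/𝔽₃·𝟙`, `3 ∤ 4`, so `tr = #Fix(σ | roots) - 1`, and the fixed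
points of Frobenius on the roots of `f` in `K̄` are the roots of `f mod 𝔭` in `𝓞 K ⧸ 𝔭` since
`𝔭 ∤ 3 · disc f · lc f` — Dedekind). -/
def Leaf.rbarTraceFrob : Prop :=
  ∀ (f : ℤ[X]) (B : Module.Basis (Fin 3) (ZMod 3) (Heart 3 (Roots f))), Generic f →
    ∀ 𝔭 ∉ badPrimes f, ∀ 𝔓 ∈ 𝔭.primesAbove, ∀ σ : absoluteGaloisGroup K, IsArithFrobAt (𝓞 K) σ 𝔓 →
      (rbar f B σ).val.trace =
        ((f.map ((Ideal.Quotient.mk 𝔭.asIdeal).comp (algebraMap ℤ (𝓞 K)))).roots.toFinset.card : ZMod 3) - 1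

/-- LEAF `rbarUnramified`: `r̄_f^B` is unramified outside `S(f)` (for `v ∤ 3 · disc f · lc f` every
inertia group `I_𝔓`, `𝔓 ∣ v`, fixes the roots of `f`: the `lc(f) · αᵢ` are algebraic integers,
pairwise distinct modulo `𝔓`). -/
def Leaf.rbarUnramified : Prop :=
  ∀ (f : ℤ[X]) (B : Module.Basis (Fin 3) (ZMod 3) (Heart 3 (Roots f))), Generic f →
    ∀ v ∉ badPrimes f, Deformation.IsUnramifiedAt v (rbar f B)

/-- LEAF `rbarPolarized`: `r̄_f^B` is polarized modulo `3` for EVERY exponent `m` and every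
`c ∈ Γ_ℚ`: `tr r̄(θ_c σ) = ε̄(σ)^m · tr r̄(σ⁻¹)`.  (The roots of `f ∈ ℤ[X]` are a `Γ_ℚ`-set, so
`θ_c σ` acts on them as a conjugate of `σ` by a permutation and has as many fixed points as `σ`,
and as `σ⁻¹`; and `ε ≡ 1 (mod 3)` on `Γ_K` because `ζ₃ ∈ K` — the composite
`ℤ₃ → 𝒪 → 𝔽₃` being the reduction map.) -/
def Leaf.rbarPolarized : Prop :=
  ∀ (f : ℤ[X]) (B : Module.Basis (Fin 3) (ZMod 3) (Heart 3 (Roots f)))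
    (𝒪 : Type) [CommRing 𝒪] [Algebra ℤ_[3] 𝒪] [Algebra 𝒪 (ZMod 3)] (m : ℤ)
    (c : absoluteGaloisGroup ℚ) (σ : absoluteGaloisGroup K),
    (rbar f B (absGaloisOuterConj ℚ K c σ)).val.trace =
      algebraMap 𝒪 (ZMod 3) (algebraMap ℤ_[3] 𝒪 (((GaloisRep.cyclotomicCharacter K 3 σ) ^ m : ℤ_[3]ˣ) : ℤ_[3])) *
        (rbar f B σ⁻¹).val.trace

/-- LEAF `rbarAbsIrreducible`: for generic `f` (`Gal(f/ℚ) ∈ {A₄, S₄}`, so the image of `Γ_K`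
on the four roots contains `A₄`) the heart `r̄_f^B` is absolutely irreducible (tree:
`augmentationRep_isIrreducible_of_alternatingGroup_le`, heart `=` augmentation module as `3 ∤ 4`). -/
def Leaf.rbarAbsIrreducible : Prop :=
  ∀ (f : ℤ[X]) (B : Module.Basis (Fin 3) (ZMod 3) (Heart 3 (Roots f))), Generic f →
    IsAbsIrreducible (rbar f B)

/-- LEAF `modelCore` (**lattice, Carayol–Serre descent to `𝒪₀`, exact reduction**).  For generic
`f` and a continuous `ρ : Γ_K → GL₃(ℚ̄₃)` unramified outside `S(f)` with the Picard Frobenius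
traces `ι⁻¹ e(a_𝔭(f))` (clause 1 of `PicardBorelAt3`), granted Carayol–Serre descent (`F2`) and
"the character determines the representation" (`F3`): `ρ` is conjugate over `ℚ̄₃` to a
homomorphism `ρ₁ : Γ_K → GL₃(𝒪₀)` (`𝒪₀ = O₀ ι e = ℤ₃[ζ₃]`) which is `𝔪`-adically continuous and
reduces EXACTLY to `r̄_f^B`.  (Model over a finite `E ⊇ E₀` by `exists_hasQlModel_holds`, stable
lattice by `exists_integralModel`; all traces lie in the closed field `E₀ ∋ ι⁻¹ e(a_𝔭)` by
`frobenius_dense`; the reduction has the traces of `r̄_f` (`picardTrace_sub_card_roots_sub_one_mem_span`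
+ LEAF `rbarTraceFrob` + density), so is conjugate to `r̄_f ⊗ k_E` by `F3` and LEAF
`rbarAbsIrreducible`; descend by `F2`, compare reductions by `F3` over `𝔽₃`, and lift the
conjugating matrix to `GL₃(𝒪₀)`.) -/
def Leaf.modelCore : Prop :=
  ∀ (f : ℤ[X]) (ι : PadicAlgCl 3 ≃+* ℂ) (e : K →+* ℂ) (B : Module.Basis (Fin 3) (ZMod 3) (Heart 3 (Roots f))),
    Generic f →
    exists_descent_of_trace_mem_of_isAbsIrreducible_residual →
    exists_conj_eq_of_trace_eq_of_isAbsIrreducible_residual →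
    ∀ ρ : FramedGaloisRep K (PadicAlgCl 3) 3,
      (∀ 𝔭 ∉ badPrimes f, ρ.IsUnramifiedAt 𝔭 ∧
        ∀ 𝔓 ∈ 𝔭.primesAbove, ∀ σ : absoluteGaloisGroup K, IsArithFrobAt (𝓞 K) σ 𝔓 →
          ρ.trace σ = picardC f ι e 𝔭) →
      ∃ (ρ₁ : absoluteGaloisGroup K →* GL (Fin 3) (O₀ ι e)) (P : GL (Fin 3) (PadicAlgCl 3)),
        (∀ σ, (ρ σ : GL (Fin 3) (PadicAlgCl 3)) = P * Matrix.GeneralLinearGroup.map (j₀ ι e) (ρ₁ σ) * P⁻¹) ∧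
        (∀ σ, (ρ₁ σ).val.map (algebraMap (O₀ ι e) (ZMod 3)) = (rbar f B σ).val) ∧
        Deformation.IsAdicContinuous ρ₁

/-- LEAF `modelBorel` (**the `λ`-flag of the `𝒪₀`-model is `E₀`-rational and reduces to a
distinguished flag**).  Let `ρ₁ : Γ_K → GL₃(𝒪₀)` reduce exactly to `r̄_f^B`, let `F₀` be a
distinguished `Γ_{K_v}`-stable flag of `r̄_f^B` at `v ∣ 3`, and suppose `ρ₁|_{Γ_{K_v}}` is
triangularisable over `ℚ̄₃`.  Then there is a frame `g ∈ GL₃(𝒪₀)` with `g⁻¹ ρ₁|_{Γ_{K_v}} g`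
upper triangular whose reduction `F = ḡ` is a distinguished flag.  (Any residual stable flag has
as diagonal characters a permutation of those of `F₀` — elementary on `3 × 3` upper triangular
forms — hence pairwise distinct and `𝔽₃`-valued; so the three `ℚ̄₃`-diagonal characters have
distinct reductions, occur with multiplicity one, are fixed by `Aut(ℚ̄₃/E₀)`, and the stable flag
is `E₀`-rational; an Iwasawa decomposition `GL₃(E₀) = GL₃(𝒪₀) · B(E₀)` makes it integral.) -/
def Leaf.modelBorel : Prop :=
  ∀ (f : ℤ[X]) (ι : PadicAlgCl 3 ≃+* ℂ) (e : K →+* ℂ) (B : Module.Basis (Fin 3) (ZMod 3) (Heart 3 (Roots f)))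
    (F₀ : GL (Fin 3) (ZMod 3)) (v : HeightOneSpectrum (𝓞 K)), (3 : 𝓞 K) ∈ v.asIdeal →
    IsDistinguishedFlag f B v F₀ →
    ∀ ρ₁ : absoluteGaloisGroup K →* GL (Fin 3) (O₀ ι e),
      (∀ σ, (ρ₁ σ).val.map (algebraMap (O₀ ι e) (ZMod 3)) = (rbar f B σ).val) →
      (∃ g : GL (Fin 3) (PadicAlgCl 3), ∀ τ,
        IsUpper3 (g⁻¹ * Matrix.GeneralLinearGroup.map (j₀ ι e) (ρ₁ (absGaloisRestrict K (v.adicCompletion K) τ)) * g).val) →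
      ∃ (F : GL (Fin 3) (ZMod 3)) (g : GL (Fin 3) (O₀ ι e)),
        IsDistinguishedFlag f B v F ∧
        IsUpper3 (F⁻¹ * Matrix.GeneralLinearGroup.map (algebraMap (O₀ ι e) (ZMod 3)) g).val ∧
        ∀ τ, IsUpper3 (g⁻¹ * ρ₁ (absGaloisRestrict K (v.adicCompletion K) τ) * g).val

end Leaves

/-! ### Small leaves, proved -/

section Small

variable (f : ℤ[X]) (B : Module.Basis (Fin 3) (ZMod 3) (Heart 3 (Roots f)))

/-- `IsUpper3 M ↔ M` is block upper triangular for `id : Fin 3 → Fin 3`. -/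
theorem isUpper3_iff_blockTriangular {R : Type*} [CommRing R] (M : Matrix (Fin 3) (Fin 3) R) :
    IsUpper3 M ↔ M.BlockTriangular id := by
  constructor
  · rintro ⟨h10, h20, h21⟩ i j hij
    fin_cases i <;> fin_cases j <;> simp_all
  · intro h
    exact ⟨h (by decide), h (by decide), h (by decide)⟩

/-- `GL_n(φ)` is injective for an injective `φ`. -/
theorem generalLinearGroup_map_injective {A C : Type*} [CommRing A] [CommRing C] {n : Type*}
    [Fintype n] [DecidableEq n] (φ : A →+* C) (hφ : Function.Injective φ) :
    Function.Injective (Matrix.GeneralLinearGroup.map (n := n) φ) := by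
  intro P Q h
  refine Units.ext (Matrix.ext fun i j => hφ ?_)
  rw [← Matrix.GeneralLinearGroup.map_apply, ← Matrix.GeneralLinearGroup.map_apply, h]

/-- Every prime of `𝓞 K` above `3` is `(ζ - 1)` (Mathlib: `3` is totally ramified in `ℚ(ζ₃)`). -/
theorem asIdeal_eq_span_zeta_sub_one (u : HeightOneSpectrum (𝓞 K)) (hu : (3 : 𝓞 K) ∈ u.asIdeal) :
    u.asIdeal = Ideal.span {isPrimitiveRoot_zetaK.toInteger - 1} := by
  haveI := isCyclotomicExtensionK
  haveI : u.asIdeal.IsPrime := u.isPrime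
  haveI : u.asIdeal.LiesOver (Ideal.span {((3 : ℕ) : ℤ)}) := by
    refine ⟨(Ideal.IsMaximal.eq_of_le ?_ ?_ ?_)⟩
    · refine Ideal.IsPrime.isMaximal ((Ideal.span_singleton_prime (by norm_num)).mpr ?_) (by simp)
      exact Int.prime_three
    · exact Ideal.comap_ne_top _ (Ideal.IsPrime.ne_top inferInstance)
    · rw [Ideal.span_singleton_le_iff_mem, Ideal.under, Ideal.mem_comap, map_natCast]
      simpa using hu
  exact IsCyclotomicExtension.Rat.eq_span_zeta_sub_one_of_liesOver' 3 (K := K) isPrimitiveRoot_zetaK u.asIdeal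

/-- **`λ = (1 - ζ₃)` is the only prime of `𝓞 K` above `3`.** -/
theorem threeUnique (v w : HeightOneSpectrum (𝓞 K)) (hv : (3 : 𝓞 K) ∈ v.asIdeal) (hw : (3 : 𝓞 K) ∈ w.asIdeal) :
    v = w :=
  HeightOneSpectrum.ext (by rw [asIdeal_eq_span_zeta_sub_one v hv, asIdeal_eq_span_zeta_sub_one w hw])

/-- The stabiliser of a root contains the (open) fixing subgroup of the field it generates. -/
theorem isOpen_stabilizer_root (α : Roots f) :
    IsOpen ((MulAction.stabilizer (absoluteGaloisGroup K) α : Subgroup (absoluteGaloisGroup K)) :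
      Set (absoluteGaloisGroup K)) := by
  set E := IntermediateField.adjoin K {(α : AlgebraicClosure K)} with hE
  haveI hfin : FiniteDimensional K E :=
    IntermediateField.adjoin.finiteDimensional (Algebra.IsIntegral.isIntegral (α : AlgebraicClosure K))
  refine Subgroup.isOpen_mono ?_ (IntermediateField.fixingSubgroup_isOpen E)
  intro σ hσ
  rw [MulAction.mem_stabilizer_iff]
  have h := (IntermediateField.mem_fixingSubgroup_iff _ _).mp hσ (α : AlgebraicClosure K)
    (IntermediateField.mem_adjoin_simple_self K _)
  exact Subtype.ext h

/-- **`r̄_f^B` has open kernel** (it factors through the action on the finitely many roots). -/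
theorem isOpen_ker_rbar : IsOpen (((rbar f B).ker : Subgroup (absoluteGaloisGroup K)) : Set (absoluteGaloisGroup K)) := by
  refine Subgroup.isOpen_mono (H₁ := ⨅ α : Roots f, MulAction.stabilizer (absoluteGaloisGroup K) α) ?_ ?_
  · intro σ hσ
    rw [Subgroup.mem_iInf] at hσ
    have hperm : permRep (ZMod 3) (absoluteGaloisGroup K) (Roots f) σ = LinearMap.id := by
      refine Finsupp.lhom_ext' fun α => LinearMap.ext_ring ?_
      rw [LinearMap.comp_apply, Finsupp.lsingle_apply, permRep_single, LinearMap.comp_apply,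
        LinearMap.id_apply, Finsupp.lsingle_apply, show σ • α = α from hσ α]
    have haug : augmentationRep (ZMod 3) (absoluteGaloisGroup K) (Roots f) σ = LinearMap.id := by
      refine LinearMap.ext fun x => Subtype.ext ?_
      rw [coe_augmentationRep_apply, hperm]
      rfl
    have hheart : heartRep 3 (Roots f) (absoluteGaloisGroup K) σ = LinearMap.id := by
      refine LinearMap.ext fun x => ?_
      obtain ⟨x, rfl⟩ := Submodule.Quotient.mk_surjective _ x
      rw [heartRep_mk, haug]
      rfl
    rw [MonoidHom.mem_ker, rbar, MonoidHom.comp_apply]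
    change Units.map _ ((heartRep 3 (Roots f) (absoluteGaloisGroup K)).asGroupHom σ) = 1
    have : (heartRep 3 (Roots f) (absoluteGaloisGroup K)).asGroupHom σ = 1 := by
      refine Units.ext ?_
      rw [Representation.asGroupHom_apply, hheart]
      rfl
    rw [this, map_one]
  · rw [Subgroup.coe_iInf]
    exact isOpen_iInter_of_finite fun α => isOpen_stabilizer_root f α

/-- **Absolutely irreducible ⟹ scalar centraliser** (Burnside: the `r̄(γ)` span `M₃(𝔽₃)`). -/
theorem hasScalarCentralizer_of_isAbsIrreducible (h : IsAbsIrreducible (rbar f B))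
    (M : Matrix (Fin 3) (Fin 3) (ZMod 3)) (hM : ∀ γ, M * (rbar f B γ).val = (rbar f B γ).val * M) :
    ∃ c : ZMod 3, M = c • (1 : Matrix (Fin 3) (Fin 3) (ZMod 3)) := by
  have hspan := (Literature.RepresentationTheory.Semisimple.span_eq_top_iff_forall_isIrreducible (by norm_num : 0 < 3) (rbar f B)).mpr h
  have hcomm : ∀ N : Matrix (Fin 3) (Fin 3) (ZMod 3), Commute N M := by
    intro N
    have hN : N ∈ Submodule.span (ZMod 3) (Set.range fun γ => (rbar f B γ).val) := by
      rw [hspan]; exact Submodule.mem_top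
    refine Submodule.span_induction ?_ ?_ ?_ ?_ hN
    · rintro _ ⟨γ, rfl⟩
      exact (hM γ).symm
    · exact Commute.zero_left M
    · intro x y _ _ hx hy
      exact hx.add_left hy
    · intro a x _ hx
      exact hx.smul_left a
  obtain ⟨c, hc⟩ := Matrix.mem_range_scalar_iff_commute_single'.mpr fun i j => hcomm (Matrix.single i j 1)
  exact ⟨c, by rw [← hc, Matrix.scalar_apply, ← Matrix.smul_one_eq_diagonal]⟩

end Small

/-- **Summary (registered helper goal of `stub_point`)**: the heart has open kernel, and an
absolutely irreducible heart has scalar centraliser. -/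
theorem pointPlan_small : ∀ (f : ℤ[X]) (B : Module.Basis (Fin 3) (ZMod 3) (Heart 3 (Roots f))), IsOpen (((rbar f B).ker : Subgroup (absoluteGaloisGroup K)) : Set (absoluteGaloisGroup K)) ∧ (IsAbsIrreducible (rbar f B) → ∀ M : Matrix (Fin 3) (Fin 3) (ZMod 3), (∀ γ, M * (rbar f B γ).val = (rbar f B γ).val * M) → ∃ c : ZMod 3, M = c • (1 : Matrix (Fin 3) (Fin 3) (ZMod 3))) :=
  fun f B => ⟨isOpen_ker_rbar f B, fun h M hM => hasScalarCentralizer_of_isAbsIrreducible f B h M hM⟩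

end

end Summit.Langlands.Langlands.Cruxes.MuOrdinaryFamilyRT.FreeSeedSmoothRt
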